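import Summits.QuantumFields.BalabanUV.T4Continuum.Spine.NE1p.DressedTransportRatioScheduled
import Summits.QuantumFields.BalabanUV.T4Continuum.Spine.NE1p.DressedRootFam

/-!
# T⁴ programme, spine estimate NE1′ (node O3b/H2) — END-ALL (ratio face): THE ROW ROOT `DressedStability 𝒯` AT EVERY CUTOFF AND
# EVERY RUN PARAMETER FROM THE DISPLAYED WALL BINDERS, THE LOCATED CELL SCALARS AND RATIO-BOUNDED WINDOW SCHEDULES
# (swarm row S3e of `t4/formal/NE1p/LEAVES.md`, typer OFFER R-T21 «END-ALL (ratio face)»; INTENT HOME/CLAIMS.log 2026-08-20T09:00:23Z)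

Cell `pub-balaban`, sub-cell `t4`, BINDER-OWNERS row NE1′ (owner lineage t4-ne1p-p1; root `Spine/NE1p/DressedRoot.lean` p211416,
budget face `Spine/NE1p/DressedRootFam.lean` p211697); swarm unit `b2b-balaban-t4-ne1p-formalise-leaf-02`; tree target
`Summits/QuantumFields/BalabanUV/T4Continuum/Spine/NE1p/`; ADDITIVE — imports `Spine/NE1p/DressedTransportRatioScheduled` (row S3d,
leaf-09: the crew's K-free per-cutoff bundle `bookingLeaves_ratio_of_schedule`, p213257; through it rows S1 ∕ S2 ∕ S2c ∕ S3 ∕ S3b)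
and `Spine/NE1p/DressedRootFam` (ROOT-B `DressedBudget`, `dressedBudget_of_dressedStabilityWith_strict`) ONLY; modifies nothing.

WHAT THIS FILE DOES.  Row S3d reaches, PER CUTOFF `K` and run parameter, the leaf bundle
`BookingLeaves (uniformConstantsCell L (4c_δ∕r) c̄ κ N₀ A₀ m s̄⁰ ρ′ …) B T` of END-B from function-level data.  END-B
(`DressedRoot.dressedStability_of_bookingLeaves`, here through row S3's `dressedStability_of_cell`) wants that bundle at EVERY
`(a, K)` of a dressed tower `𝒯 : DressedTower P` with ONE `UniformConstants`.  This file is the composition and nothing else: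
* §1 the binders, ONCE, as section variables — per `(a, K)`: a window schedule `W a K : WindowSchedule r w` with the K-free
  diameter∕radius ratio `2σ ≤ κ·ϱc` (`hratio`), the ratio-END's wall ∕ dictionary family ((w1) `hsl`, H2 `hFn`∕`h𝒢`∕`hQ`∕`hSg`∕
  `hs1`∕`hAsz_*`, (w2-act) `hB`∕`hE` — THE NUMBER `s a K b k ≤ s̄⁰` —, (I4′) `hlink`∕`hδfw`∕`hpairx`∕`hdefw`∕`hrate`, `hDμ`∕`hz₁`,
  `hinv`, `hmeas`, `hlin`), (w5) `hc0`∕`hcb`∕`hreg`, (w2-act) `hs₀`, (w3-book) `hS`∕`hcount`, (w1)+(w5b) `hbirth`; and, ONCE for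
  all `(a, K)`, the twelve K-∕μ-∕a-FREE scalars of row S3's cell (`1 ≤ L`, signs, the located largeness
  `locCell L (4c_δ∕r) c̄ κ ≤ ρ′ < 1` ((w7)), the window `m·(N₀A₀(1−ρ′)⁻¹) ≤ 1 − s̄⁰` ((w6)), `0 < r`, `0 ≤ c_δ`, `0 ≤ κ`).
* §2 **`dressedStability_of_ratioSchedules : DressedStability 𝒯`** — THE ROW ROOT, conclusion LITERAL (c4); the same cell
  `uniformConstantsCell …` serves every `(a, K)` BY CONSTRUCTION (RULING R-t4r2-Q2 ∕ caveat k1: the constants precede `∀ a` and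
  `∀ K`); `dressedStabilityWith_of_ratioSchedules` displays them: `(A₀, rhoOne L⁻² (4c_δ∕r) c̄ κ, L⁻³)`.
* §3 the ROOT-B hand-off `dressedBudget_of_ratioSchedules : DressedBudget 𝒯 wt` — with the bookings' K-free positional counts
  `N₀·(L⁴)^{k−j}` of the births FELT at cubes (row S4's currency, displayed) and bounded nonnegative cube weights, by
  `DressedRoot.dressedBudget_of_dressedStabilityWith_strict` (file `DressedRootFam`) (the strict product is the cell's `hprod`, i.e. `hloc`).

HONEST FRAMING.  A COMPOSITION FACE: 0 estimates, 0 new hypothesis shapes, NO `def … : Prop`, every wall binder displayed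
verbatim as row S3d displays it, now indexed by `(a, K)`.  Headline (c4): «NE1′ (all cutoffs, all run parameters) ⇐ the displayed
wall binders ∀ (a,K) + the located largeness∕window + ratio-bounded schedules» — NOT «NE1′ proved»: the walls (w1) births,
(w2-act) THE NUMBER, (w5) regeneration, F-6's rate (in `hlink`∕`hrate`) are asserted for Bałaban's densities NOWHERE, and the
schedules' window budget (`ρw K + K·w ≤ ρw 0`, LF-1's window half; K-free exit = leaf-08's per-step windows R-b) sits inside
`hsl`'s window.  LOCATED COSTS CARRIED VERBATIM (typer rulings R-T21 ∕ R-T27): LF-1 (F-ne1pleaf08-1) — every `W a K : WindowSchedule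
r w` has gap `≥ w + ϱ₁ k + σ k` per met step, so the birth window of the displayed binder `hsl` (births analytic on
`bondBall d ((W a K).ρw k′)`) GROWS WITH THE CUTOFF: `(W a K).ρw 0 ≥ (W a K).ρw K + K·w` (`WindowSchedule.window_budget`); LF-2
(F-ne1pleaf04-1) — the uniform slice window `w` survives in the cross-family binders `hN2cx` ∕ `hpairx` of the assembled leaf, so
no bond-ball schedule serving THIS face is cutoff-free; the cutoff-free faces are leaf-08's per-step-window chain (R-b,
`DressedRootWin`) and leaf-04's slice-window re-cut (S1e) — this file asserts neither.  (v1.1 DOCFIX: this paragraph only; no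
declaration, statement or proof touched.)  0 binders instantiated on Bałaban's densities; spine PROVED 0∕9.  Rung (B)+1 on ONE finite four-torus — NOT
infinite volume, NOT a mass gap, NOT OS on ℝ⁴, NOT the Clay problem, NOT summit progress.  [folklore] kernel glue, 0 sorry,
0 citations.  HONEST DEPENDENCY: continuum YM on T⁴ ⇐ BetaPertH ∧ nine spine estimates (0/9 proved); BetaPertH ⇐ (D1) ∧ (D4) ∧
CAP+tail; G-an2-4 gates asym, D1 and NE2/3/4.
-/

noncomputable section

namespace Summit.QuantumFields.BalabanUV.T4Continuum.NE1p.DressedStabilityOfRatioSchedules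

open MeasureTheory Set Metric Finset
open scoped BigOperators
open Literature.MathematicalPhysics.QuantumFieldTheory.Balaban1983to89
open Literature.MathematicalPhysics.QuantumFieldTheory.Balaban1983to89.T4TermFormat
open Literature.MathematicalPhysics.QuantumFieldTheory.Balaban1983to89.T4GatedBooking
open Literature.MathematicalPhysics.QuantumFieldTheory.Balaban1983to89.T4TrajectoryComparison
open Literature.MathematicalPhysics.QuantumFieldTheory.Balaban1983to89.T4TrajectoryModulus
open T4BirthChartTransport (GaugeInvariant BirthSlice RelGauge)
open T4BlockTransport (Fld NDir latMove latN)
open T4TrajectoryDensity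
open Summit.QuantumFields.BalabanUV.T4Continuum.T4TrajectoryDensityDressed
open Summit.QuantumFields.BalabanUV.T4Continuum.NE1p.DressedRoot
open Summit.QuantumFields.BalabanUV.T4Continuum.NE1p.DressedWindowSchedule
open Summit.QuantumFields.BalabanUV.T4Continuum.NE1p.DressedUniformConstants
open Summit.QuantumFields.BalabanUV.T4Continuum.NE1p.DressedTransportRatioScheduled

/-! ## §1 The binders, once, indexed by run parameter and cutoff -/

section EndAll

variable {P : Type*} (𝒯 : DressedTower P)
variable {R : Type*} [NormedRing R] [NormedAlgebra ℂ R] [MeasurableSpace R] {d : ℕ}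
variable {r w κ L cbar N₀ A₀ sbar ρ' cδ m : ℝ}
variable (W : ∀ (a : P) (K : ℕ), WindowSchedule r w) (hκ : 0 ≤ κ)
variable {Fn : ∀ (a : P) (K : ℕ), (𝒯.B a K).Birth → ℕ → ℕ → Fld d R → ℂ}
  {rel : ∀ (a : P) (K : ℕ), (𝒯.B a K).Birth → ℕ → ℕ → Fld d R → Fld d R → Prop}
  {ref : ∀ (a : P) (K : ℕ), (𝒯.B a K).Birth → ℕ → Fld d R → Fld d R}
  {base : ∀ (a : P) (K : ℕ), (𝒯.B a K).Birth → ℕ → Fld d R → ℝ}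
  {𝒜 𝒬 : ∀ (a : P) (K : ℕ), (𝒯.B a K).Birth → ℕ → Fld d R → Fld d R → ℂ}
  {q : ∀ (a : P) (K : ℕ), (𝒯.B a K).Birth → ℕ → Fld d R → ℂ}
  {μ : ∀ (a : P) (K : ℕ), (𝒯.B a K).Birth → ℕ → Measure (Fld d R)}
  {z₀ z₁ : ∀ (a : P) (K : ℕ), (𝒯.B a K).Birth → ℕ → Fld d R}
  {defect : ∀ (a : P) (K : ℕ), (𝒯.B a K).Birth → ℕ → ℕ → ℝ}
  {s s1 : ∀ (a : P) (K : ℕ), (𝒯.B a K).Birth → ℕ → ℝ}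
  {Asz : ∀ (a : P) (K : ℕ), (𝒯.B a K).Birth → ℕ → ℕ → ℝ}
  {S : ∀ (a : P) (K : ℕ), ℕ → (𝒯.B a K).Birth → Finset (𝒯.B a K).Birth}
  {Sg : ∀ (a : P) (K : ℕ), ℕ → (𝒯.B a K).Birth → Finset ((𝒯.B a K).Birth × ℕ)}
  {c : ∀ (a : P) (K : ℕ), (𝒯.B a K).Birth → ℕ → ℂ}
  {δf : ∀ (a : P) (K : ℕ), (𝒯.B a K).Birth → ℕ → (𝒯.B a K).Birth × ℕ → ℝ}
  {creg : ∀ (_ : P) (_ : ℕ), ℕ → ℝ}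

variable (hratio : ∀ (a : P) (K : ℕ), ∀ k, 2 * (W a K).σ k ≤ κ * (W a K).ϱc k)
-- row S3's located scalars ((w7) largeness, (w6) window) and signs
variable (hL : 1 ≤ L)
variable (hcbar : 0 ≤ cbar)
variable (hN₀ : 0 ≤ N₀)
variable (hA₀ : 0 ≤ A₀)
variable (hm : 0 ≤ m)
variable (hloc : locCell L (4 * cδ / r) cbar κ ≤ ρ')
variable (hρ'1 : ρ' < 1)
variable (hsmall : m * (N₀ * A₀ * (1 - ρ')⁻¹) ≤ 1 - sbar)
-- scalars of the ratio-END
variable (hr : 0 < r)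
variable (hcδ : 0 ≤ cδ)
-- the ratio-END's wall ∕ dictionary binders at ψ := L⁻²
variable (hsl : ∀ (a : P) (K : ℕ), ∀ (b : (𝒯.B a K).Birth) (k' : ℕ), (𝒯.B a K).birthScale b ≤ k' → k' ≤ (𝒯.B a K).K →
  RanBelow (budgetGate (𝒯.T a K) (s a K) m (S a K) (4 * cδ / r) (fun i => (L ^ 2)⁻¹ * (fun _ : ℕ => alphaCell κ) i)) k' →
  BirthSlice ((Fn a K) b k' k') latMove latN (bondBall d ((W a K).ρw k') : Set (Fld d R)) w r ((𝒯.T a K).gen b k'))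
variable (hFn : ∀ (a : P) (K : ℕ), ∀ (b : (𝒯.B a K).Birth) (k' k : ℕ), (𝒯.B a K).birthScale b ≤ k' → k' ≤ k → k + 1 ≤ (𝒯.B a K).K →
  RanBelow (budgetGate (𝒯.T a K) (s a K) m (S a K) (4 * cδ / r) (fun i => (L ^ 2)⁻¹ * (fun _ : ℕ => alphaCell κ) i)) (k + 1) →
  ∀ U, (Fn a K) b k' (k + 1) U =
  wOp (expWeight ((base a K) b k) ((𝒜 a K) b k + (𝒬 a K) b k)) ((μ a K) b k) ((z₀ a K) b k) U (fun z => (Fn a K) b k' k (U + z)))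
variable (h𝒢 : ∀ (a : P) (K : ℕ), ∀ (b : (𝒯.B a K).Birth) (k' k : ℕ), (𝒯.B a K).birthScale b ≤ k' → k' ≤ k → k + 1 ≤ (𝒯.B a K).K →
  RanBelow (budgetGate (𝒯.T a K) (s a K) m (S a K) (4 * cδ / r) (fun i => (L ^ 2)⁻¹ * (fun _ : ℕ => alphaCell κ) i)) (k + 1) →
  ∀ U, (fun z => (Fn a K) b k' k (U + z)) ∈ BddClass ℂ ((μ a K) b k))
variable (hB : ∀ (a : P) (K : ℕ), ∀ (b : (𝒯.B a K).Birth) (k' k : ℕ), (𝒯.B a K).birthScale b ≤ k' → k' ≤ k → k + 1 ≤ (𝒯.B a K).K →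
  RanBelow (budgetGate (𝒯.T a K) (s a K) m (S a K) (4 * cδ / r) (fun i => (L ^ 2)⁻¹ * (fun _ : ℕ => alphaCell κ) i)) (k + 1) →
  RealBaseAt ((ref a K) b k) ((base a K) b k) ((𝒜 a K) b k) ((μ a K) b k) (bondBall d ((W a K).ρw (k + 1)) : Set (Fld d R)))
variable (hE : ∀ (a : P) (K : ℕ), ∀ (b : (𝒯.B a K).Birth) (k' k : ℕ), (𝒯.B a K).birthScale b ≤ k' → k' ≤ k → k + 1 ≤ (𝒯.B a K).K →
  RanBelow (budgetGate (𝒯.T a K) (s a K) m (S a K) (4 * cδ / r) (fun i => (L ^ 2)⁻¹ * (fun _ : ℕ => alphaCell κ) i)) (k + 1) →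
  ExponentSliceAt ((ref a K) b k) ((𝒜 a K) b k) ((μ a K) b k) latMove latN (bondBall d ((W a K).ρw (k + 1)) : Set (Fld d R)) w ((W a K).ϱc k)
  ((s a K) b k))
variable (hQ : ∀ (a : P) (K : ℕ), ∀ b k, (fun U z => (𝒬 a K) b k U z - (q a K) b k U) =
  fun U z => (c a K) b k * ∑ p ∈ (Sg a K) k b, ((Fn a K) p.1 p.2 k (U + z) - (Fn a K) p.1 p.2 k (U + (z₁ a K) b k)))
variable (hSg : ∀ (a : P) (K : ℕ), ∀ k b, ∀ p ∈ (Sg a K) k b, p.1 ∈ (S a K) k b ∧ (𝒯.B a K).birthScale p.1 ≤ p.2 ∧ p.2 ≤ k)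
variable (hs1 : ∀ (a : P) (K : ℕ), ∀ b k, (s1 a K) b k = ‖(c a K) b k‖ * ∑ p ∈ (Sg a K) k b, 4 * (Asz a K) p.1 p.2 k / (W a K).sliceR p.2 k * (δf a K) b k p)
variable (hAsz_birth : ∀ (a : P) (K : ℕ), ∀ f k'', (Asz a K) f k'' k'' = (𝒯.T a K).gen f k'')
variable (hAsz_step : ∀ (a : P) (K : ℕ), ∀ f k'' k, (𝒯.B a K).birthScale f ≤ k'' → k'' ≤ k →
  (Asz a K) f k'' (k + 1) = Real.exp (3 * ((s a K) f k + (s1 a K) f k)) * (Asz a K) f k'' k)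
variable (hlink : ∀ (a : P) (K : ℕ), ∀ b k, ∀ p ∈ (Sg a K) k b,
  0 ≤ (δf a K) b k p ∧ ‖(c a K) b k‖ * ((δf a K) b k p / (W a K).sliceR p.2 k) ≤ m * (cδ / r) * ((L ^ 2)⁻¹) ^ (k - p.2))
variable (hδfw : ∀ (a : P) (K : ℕ), ∀ b k, ∀ p ∈ (Sg a K) k b, (δf a K) b k p ≤ w)
variable (hDμ : ∀ (a : P) (K : ℕ), ∀ b k, ∀ᵐ z ∂(μ a K) b k, z ∈ (bondBall d ((W a K).σ k) : Set (Fld d R)))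
variable (hz₁ : ∀ (a : P) (K : ℕ), ∀ b k, (z₁ a K) b k ∈ (bondBall d ((W a K).σ k) : Set (Fld d R)))
variable (hpairx : ∀ (a : P) (K : ℕ), ∀ (b : (𝒯.B a K).Birth) (k' k : ℕ), (𝒯.B a K).birthScale b ≤ k' → k' ≤ k →
  ∀ p ∈ (Sg a K) k b, ∀ U₀ ∈ (bondBall d ((W a K).ρw (k + 1)) : Set (Fld d R)), ∀ pd : NDir d R, 0 < latN pd → latN pd ≤ w →
  ∀ᵐ z ∂(μ a K) b k, ∀ t ∈ tube ((W a K).ϱ₁ k / latN pd),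
  RelGauge ((rel a K) p.1 p.2 k) latMove latN (latMove U₀ pd t + (z₁ a K) b k) (latMove U₀ pd t + z) ((δf a K) b k p))
variable (hinv : ∀ (a : P) (K : ℕ), ∀ b k' k, GaugeInvariant ((rel a K) b k' k) ((Fn a K) b k' k))
variable (hmeas : ∀ (a : P) (K : ℕ), ∀ (b f : (𝒯.B a K).Birth) (k'' k : ℕ) (U : Fld d R), AEStronglyMeasurable (fun z => (Fn a K) f k'' k (U + z)) ((μ a K) b k))
variable (hdefw : ∀ (a : P) (K : ℕ), ∀ b k' k, (defect a K) b k' k ≤ w)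
variable (hrate : ∀ (a : P) (K : ℕ), ∀ (b : (𝒯.B a K).Birth) (k' k : ℕ), (𝒯.B a K).birthScale b ≤ k' → k' ≤ k → k ≤ (𝒯.B a K).K →
  (defect a K) b k' k ≤ cδ * ((L ^ 2)⁻¹) ^ (k - k'))
variable (hlin : ∀ (a : P) (K : ℕ), ∀ (b : (𝒯.B a K).Birth) (k' k : ℕ), (𝒯.B a K).birthScale b ≤ k' → k' ≤ k → k ≤ (𝒯.B a K).K →
  RanBelow (budgetGate (𝒯.T a K) (s a K) m (S a K) (4 * cδ / r) (fun i => (L ^ 2)⁻¹ * (fun _ : ℕ => alphaCell κ) i)) k →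
  ∀ ε > 0, ∃ U₀ ∈ (bondBall d ((W a K).ρw k) : Set (Fld d R)), ∃ U₁ : Fld d R,
  RelGauge ((rel a K) b k' k) latMove latN U₀ U₁ ((defect a K) b k' k) ∧
  (𝒯.T a K).lin b k' k ≤ ‖(Fn a K) b k' k U₁ - (Fn a K) b k' k U₀‖ + ε)
-- the booking-level wall binders: (w5) regeneration, (w2-act) margin, (w3-book) counts, (w1)+(w5b) births
variable (hc0 : ∀ (a : P) (K : ℕ), ∀ k, 0 ≤ (creg a K) k)
variable (hcb : ∀ (a : P) (K : ℕ), ∀ k, k < (𝒯.B a K).K → (creg a K) k ≤ cbar)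
variable (hreg : ∀ (a : P) (K : ℕ), (𝒯.T a K).RegeneratesFromVar (creg a K)
  (budgetGate (𝒯.T a K) (s a K) m (S a K) (4 * cδ / r) (fun _ : ℕ => (L ^ 2)⁻¹ * alphaCell κ)))
variable (hs₀ : ∀ (a : P) (K : ℕ), ∀ b k, (s a K) b k ≤ sbar)
variable (hS : ∀ (a : P) (K : ℕ), ∀ k b, ∀ f ∈ (S a K) k b, (𝒯.B a K).birthScale f ≤ k)
variable (hcount : ∀ (a : P) (K : ℕ), ∀ k b, ∀ j ≤ k, ((((S a K) k b).filter fun f => (𝒯.B a K).birthScale f = j).card : ℝ) ≤ N₀ * (L ^ 4) ^ (k - j))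
variable (hbirth : ∀ (a : P) (K : ℕ), (𝒯.T a K).BirthsFromOld (4 * cδ / r) (fun _ : ℕ => (L ^ 2)⁻¹ * alphaCell κ)
  (twoRate A₀ (rhoOne (L ^ 2)⁻¹ (4 * cδ / r) cbar κ) (L⁻¹ ^ 3) (𝒯.B a K).K)
  (budgetGate (𝒯.T a K) (s a K) m (S a K) (4 * cδ / r) (fun _ : ℕ => (L ^ 2)⁻¹ * alphaCell κ)))

include W hκ hratio hL hcbar hN₀ hA₀ hm hloc hρ'1 hsmall hr hcδ hsl hFn h𝒢 hB hE hQ hSg hs1 hAsz_birth hAsz_step hlink hδfw hDμ hz₁ hpairx hinv hmeas hdefw hrate hlin hc0 hcb hreg hs₀ hS hcount hbirth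

/-! ## §2 END-ALL: the row root at every cutoff and run parameter -/

/-- **END-ALL (ratio face) — THE ROW ROOT `DressedStability 𝒯`** [bookkeeping]: at every run parameter `a` and every cutoff `K`
the displayed wall binders of the ratio-END chain (rows S1∕S2c∕S3∕S3d BY NAME) over a ratio-bounded window schedule `W a K`,
plus — ONCE — the K-∕μ-∕a-free located scalars of row S3's cell, give `DressedStability 𝒯` through END-B
(`dressedStability_of_cell` = `dressedStability_of_bookingLeaves` at `uniformConstantsCell …`).  The constants precede `∀ a` and
`∀ K` by construction (RULING R-t4r2-Q2).  NOT «NE1′ proved»: every estimate binder is displayed; 0 instantiated on Bałaban's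
densities; the displayed `hsl` birth window `(W a K).ρw k′` is K-GROWING under any such schedule (LF-1's window half, LF-2) until the
per-step ∕ slice-window faces replace `W`. [folklore] -/
theorem dressedStability_of_ratioSchedules : DressedStability 𝒯 :=
  dressedStability_of_cell 𝒯 hL (div_nonneg (mul_nonneg (by norm_num) hcδ) hr.le) hcbar hκ hN₀ hA₀ hm hloc hρ'1 hsmall
    (fun a K =>
      bookingLeaves_ratio_of_schedule (W a K) (hratio a K) hL hcbar hN₀ hA₀ hm hloc hρ'1 hsmall hr hcδ (hsl a K) (hFn a K)
        (h𝒢 a K) (hB a K) (hE a K) (hQ a K) (hSg a K) (hs1 a K) (hAsz_birth a K) (hAsz_step a K) (hlink a K) (hδfw a K)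
        (hDμ a K) (hz₁ a K) (hpairx a K) (hinv a K) (hmeas a K) (hdefw a K) (hrate a K) (hlin a K) (hc0 a K) (hcb a K)
        (hreg a K) (hs₀ a K) (hS a K) (hcount a K) (hbirth a K))

/-- **… WITH THE CONSTANTS DISPLAYED** [bookkeeping]: the class at every `(a, K)` is
`twoRate A₀ (rhoOne L⁻² (4c_δ∕r) c̄ κ) L⁻³ K` — `σ j k = A₀·(L⁻²·e³(1+4κ) + (4c_δ∕r)·c̄)^{k−j}·(L⁻³)^{K−j}`. [folklore] -/
theorem dressedStabilityWith_of_ratioSchedules :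
    DressedStabilityWith 𝒯 A₀ (rhoOne (L ^ 2)⁻¹ (4 * cδ / r) cbar κ) (L⁻¹ ^ 3) :=
  dressedStabilityWith_of_bookingLeaves
    (uniformConstantsCell L (4 * cδ / r) cbar κ N₀ A₀ m sbar ρ' hL (div_nonneg (mul_nonneg (by norm_num) hcδ) hr.le) hcbar hκ
      hN₀ hA₀ hm hloc hρ'1 hsmall) 𝒯
    (fun a K =>
      bookingLeaves_ratio_of_schedule (W a K) (hratio a K) hL hcbar hN₀ hA₀ hm hloc hρ'1 hsmall hr hcδ (hsl a K) (hFn a K)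
        (h𝒢 a K) (hB a K) (hE a K) (hQ a K) (hSg a K) (hs1 a K) (hAsz_birth a K) (hAsz_step a K) (hlink a K) (hδfw a K)
        (hDμ a K) (hz₁ a K) (hpairx a K) (hinv a K) (hmeas a K) (hdefw a K) (hrate a K) (hlin a K) (hc0 a K) (hcb a K)
        (hreg a K) (hs₀ a K) (hS a K) (hcount a K) (hbirth a K))

/-! ## §3 The ROOT-B hand-off -/

/-- **END-ALL ⟹ ROOT-B `DressedBudget 𝒯 wt`** [bookkeeping]: with, in addition, the bookings' K-free POSITIONAL COUNTS of the
births FELT at cubes `#{b felt at q : j_b = j} ≤ N₀·(L⁴)^{k−j}` (row S4's currency — a displayed binder of the instantiation) and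
nonnegative cube weights bounded by `w̄`, the budget root of record `DressedRoot.DressedBudget` (file `DressedRootFam`) holds with
`c_B = w̄·N₀A₀∕(1−ρ′)` (`dressedBudget_of_dressedStabilityWith_strict`; the strict product `L⁴·ρ₁·L⁻³ ≤ ρ′ < 1` IS the cell's
located largeness `hloc`, `prod_cell`). [folklore] -/
theorem dressedBudget_of_ratioSchedules {wt : P → ℕ → ℕ → ℝ} {wbar : ℝ} (hwbar : 0 ≤ wbar)
    (hw0 : ∀ a K, ∀ j ≤ K, 0 ≤ wt a K j) (hwb : ∀ a K, ∀ j ≤ K, wt a K j ≤ wbar)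
    (hcountB : ∀ a K, (𝒯.B a K).PositionalCount fun j k => N₀ * (L ^ 4) ^ (k - j)) :
    DressedBudget 𝒯 wt :=
  dressedBudget_of_dressedStabilityWith_strict
    (dressedStabilityWith_of_ratioSchedules 𝒯 W hκ hratio hL hcbar hN₀ hA₀ hm hloc hρ'1 hsmall hr hcδ hsl hFn h𝒢 hB hE hQ hSg
      hs1 hAsz_birth hAsz_step hlink hδfw hDμ hz₁ hpairx hinv hmeas hdefw hrate hlin hc0 hcb hreg hs₀ hS hcount hbirth)
    hN₀ (pow_nonneg (by linarith) 4) (by rw [prod_cell (by linarith)]; exact hloc) hρ'1 hwbar hw0 hwb hcountB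

end EndAll

end Summit.QuantumFields.BalabanUV.T4Continuum.NE1p.DressedStabilityOfRatioSchedules

end
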